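import Literature.NumberTheory.Sieve.FriedlanderIwaniecPrimes
import Literature.NumberTheory.LFunctions.MertensConstant
import Mathlib.NumberTheory.AbelSummation
import Mathlib.NumberTheory.Chebyshev
import HarnessLib

/-!
# Friedlander–Iwaniec, *The polynomial `X² + Y⁴` captures its primes*: hypothesis (2.7) from Siegel–Walfisz

Family `parity`, statement parity.S17. Source: J. Friedlander, H. Iwaniec, Ann. of Math. (2) 148
(1998), 945–1040 [FriedlanderIwaniecAnnals1998], §3, paragraph after Proposition 3.5: "The
asymptotic formula (2.7) is derived from the Prime Number Theorem for the primes in residue classes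
modulo four."

`Literature.NumberTheory.Sieve.FriedlanderIwaniecPrimes` vendors hypothesis (2.7) of FI's
Proposition 2.1 for the density `g` of (3.16) (`g(p) p = 1 + χ₄(p)(1 - 1/p)`) as the named fact
`FriedlanderIwaniec1998_hyp27`: `Σ_{p ≤ y} g(p) = log log y + c + O((log y)^{-10})` for `y ≥ 2`.
This file PROVES it from the tree's standard named fact `siegel_walfisz` (parity.S28,
`ParityWave0`: `ψ(x; q, a) = x/φ(q) + O_A(x (log x)^{-A})` for `q ≤ (log x)^A`), used only for
`q ∈ {1, 4}` and `A = 12`: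

* `hyp27_of_siegelWalfisz : siegel_walfisz → FriedlanderIwaniec1998_hyp27`
  (`FriedlanderIwaniec1998_hyp27_of_siegelWalfisz`); combined with
  `FriedlanderIwaniecPrimesSquarefreeProofs` (`…_of_sq_inputs`), parity.S17 follows from
  Propositions 2.1, 3.5, 4.1 of FI (as printed) and Siegel–Walfisz.

## Proof

`g(p) = 1/p + χ₄(p)/p - χ₄(p)/p²`. For a weight `b` with `|b| ≤ 1` write
`Θ_b(x) = Σ_{p ≤ x} b(p) log p`, `S_b(x) = Σ_{p ≤ x} b(p) log p/p`, `P_b(x) = Σ_{p ≤ x} b(p)/p`.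
1. Abel summation (Mathlib's `sum_mul_eq_sub_sub_integral_mul`, as in the tree's
   `Literature.NumberTheory.LFunctions.Mertens.primeRecipSum_eq_add_integral`): `S_b(x) = Θ_b(x)/x + ∫_2^x Θ_b(t) t⁻² dt`
   (`sum_mul_log_div_eq`) and `P_b(x) = S_b(x)/log x + ∫_2^x S_b(t) dt/(t log² t)` (`sum_div_eq`).
2. If `|Θ_b(t) - m t| ≤ C t (log t)^{-12}` (`t ≥ 2`) then `|S_b(x) - m log x - c| ≤ C' (log x)^{-11}`
   (`mertensI_of_chebyshev`) and then `|P_b(x) - m log log x - C₀| ≤ C'' (log x)^{-12}`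
   (`mertensII_of_mertensI`), the constants being `c = m - m log 2 + ∫_2^∞ E t⁻²`,
   `C₀ = m - m log log 2 + c/log 2 + ∫_2^∞ ρ(t) dt/(t log² t)`; the tails are controlled by
   `∫_x^∞ dt/(t (log t)^{k+1}) = 1/(k (log x)^k)` (`integral_Ioi_inv_div_log_pow`).
3. Inputs (`chebyshev_inputs_of_siegelWalfisz`): `θ(x) = x + O(x (log x)^{-12})` (Siegel–Walfisz
   with `q = 1`, and `ψ - θ ≤ 2 √x log x`, Mathlib's `Chebyshev.psi_sub_theta_le`), and
   `Σ_{p ≤ x} χ₄(p) log p = (ψ(x;4,1) - x/2) - (ψ(x;4,3) - x/2) + O(ψ(x) - θ(x)) = O(x (log x)^{-12})`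
   (`q = 4`; `χ₄(n) = [n ≡ 1] - [n ≡ 3]`, `chi4_cast_eq_ite_sub`); uniformly down to `x = 2` by the
   trivial bound `θ(x) ≤ (log 4) x` on `[2, 4]`.
4. `Σ_{p ≤ y} χ₄(p)/p² = D₃ + O(1/y)` (absolutely convergent), and `1/y, (log y)^{-12} ≪ (log y)^{-10}`.

## References

* J. Friedlander, H. Iwaniec, *The polynomial `X² + Y⁴` captures its primes*, Ann. of Math. (2)
  148 (1998), 945–1040, §3 (paragraph after Proposition 3.5) and §2 (2.7).
  [cite: FriedlanderIwaniecAnnals1998, §3, paragraph after Proposition 3.5]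
* A. Walfisz, *Zur additiven Zahlentheorie. II*, Math. Z. 40 (1936), 592–607 (Siegel–Walfisz; the
  tree's named fact `siegel_walfisz`, [Walfisz1936]).
* G. H. Hardy, E. M. Wright, *An Introduction to the Theory of Numbers*, 6th ed., OUP 2008, §22.7
  (22.7.3) (the partial summations), as formalised in the tree's `MertensConstant`.
  [cite: HardyWright2008, §22.7 eq. (22.7.3)]

## Mathlib / tree

Tree: `siegel_walfisz`, `chebyshevPsiMod`, `chebyshevPsiMod_one` (`ParityWave0`); `fiDensity_prime`,
`FriedlanderIwaniec1998_hyp27` (`FriedlanderIwaniecPrimes`); `Literature.NumberTheory.LFunctions.Mertens.primesLE_two`,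
`Literature.NumberTheory.LFunctions.Mertens.continuousOn_inv_div_log` (`MertensConstant`). Mathlib: `sum_mul_eq_sub_sub_integral_mul`,
`Chebyshev.theta_eq_sum_primesLE`, `Chebyshev.psi_sub_theta_le`, `Chebyshev.psi_sub_theta_eq_sum_not_prime`,
`Chebyshev.theta_le_log4_mul_x`, `ZMod.χ₄_nat_eq_if_mod_four`, `ArithmeticFunction.vonMangoldt.residueClass`,
`integral_Ioi_of_hasDerivAt_of_tendsto`, `integrableOn_Ioi_deriv_of_nonneg`, `Real.log_le_rpow_div`,
`Real.tsum_le_of_sum_range_le`, `sum_Ioc_inv_sq_le_sub`. No definitions are introduced.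
-/

noncomputable section

open Filter Finset Real MeasureTheory Set
open scoped Topology Chebyshev

namespace Literature.NumberTheory.Sieve.FriedlanderIwaniecPrimesHyp27

/-! ## Stage 1: weighted Mertens theorems from a Chebyshev-type hypothesis -/

/-- A prime sum `t ↦ Σ_{p ≤ t} w(p)` is a measurable step function of `t`. [folklore] -/
theorem measurable_primeSum (w : ℕ → ℝ) :
    Measurable (fun t : ℝ => ∑ p ∈ Nat.primesLE ⌊t⌋₊, w p) := by
  have : (fun t : ℝ => ∑ p ∈ Nat.primesLE ⌊t⌋₊, w p) =
      (fun n : ℕ => ∑ p ∈ Nat.primesLE n, w p) ∘ Nat.floor := by funext t; rfl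
  rw [this]
  exact (measurable_from_nat (f := fun n : ℕ => ∑ p ∈ Nat.primesLE n, w p)).comp Nat.measurable_floor

/-- `|Σ_{p ≤ t} b(p) log p| ≤ θ(t) ≤ (log 4) t` for `|b| ≤ 1`, `t ≥ 0`. [folklore] -/
theorem abs_sum_mul_log_le {b : ℕ → ℝ} (hb : ∀ n, |b n| ≤ 1) {t : ℝ} (ht : 0 ≤ t) :
    |∑ p ∈ Nat.primesLE ⌊t⌋₊, b p * Real.log p| ≤ Real.log 4 * t := by
  calc |∑ p ∈ Nat.primesLE ⌊t⌋₊, b p * Real.log p| ≤ ∑ p ∈ Nat.primesLE ⌊t⌋₊, |b p * Real.log p| :=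
        Finset.abs_sum_le_sum_abs _ _
    _ ≤ ∑ p ∈ Nat.primesLE ⌊t⌋₊, Real.log p := by
        refine Finset.sum_le_sum fun p hp => ?_
        have hp1 : (1 : ℝ) ≤ p := by exact_mod_cast (Nat.prime_of_mem_primesLE hp).one_le
        rw [abs_mul, abs_of_nonneg (Real.log_nonneg hp1)]
        calc |b p| * Real.log p ≤ 1 * Real.log p := mul_le_mul_of_nonneg_right (hb p) (Real.log_nonneg hp1)
          _ = Real.log p := one_mul _
    _ = θ t := (Chebyshev.theta_eq_sum_primesLE t).symm
    _ ≤ Real.log 4 * t := Chebyshev.theta_le_log4_mul_x ht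

/-- `∫_x^∞ dt/(t (log t)^{k+1}) = 1/(k (log x)^k)` for `x > 1`, `k ≥ 1`, and the integrand is
integrable there. [folklore] -/
theorem integral_Ioi_inv_div_log_pow {x : ℝ} (hx : 1 < x) {k : ℕ} (hk : 1 ≤ k) :
    IntegrableOn (fun t : ℝ => t⁻¹ / Real.log t ^ (k + 1)) (Ioi x) ∧
      ∫ t in Ioi x, t⁻¹ / Real.log t ^ (k + 1) = 1 / (k * Real.log x ^ k) := by
  obtain ⟨m, rfl⟩ : ∃ m, k = m + 1 := ⟨k - 1, by omega⟩
  have hk0 : ((m + 1 : ℕ) : ℝ) ≠ 0 := by exact_mod_cast Nat.succ_ne_zero m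
  have hderiv : ∀ t ∈ Ici x,
      HasDerivAt (fun t : ℝ => -(1 / ((m + 1 : ℕ) * Real.log t ^ (m + 1))))
        (t⁻¹ / Real.log t ^ (m + 1 + 1)) t := by
    intro t ht
    have ht1 : 1 < t := hx.trans_le ht
    have ht0 : t ≠ 0 := by linarith
    have hl : Real.log t ≠ 0 := (Real.log_pos ht1).ne'
    have h1 : HasDerivAt (fun t : ℝ => Real.log t ^ (m + 1)) (((m + 1 : ℕ) : ℝ) * Real.log t ^ m * t⁻¹) t := by
      have := (Real.hasDerivAt_log ht0).pow (m + 1)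
      simp only [Nat.add_sub_cancel] at this
      exact this
    have h2 : HasDerivAt (fun t : ℝ => ((m + 1 : ℕ) : ℝ) * Real.log t ^ (m + 1))
        (((m + 1 : ℕ) : ℝ) * (((m + 1 : ℕ) : ℝ) * Real.log t ^ m * t⁻¹)) t := h1.const_mul _
    have h3 := (h2.inv (mul_ne_zero hk0 (pow_ne_zero _ hl))).neg
    simp only [one_div]
    refine h3.congr_deriv ?_
    field_simp
    ring
  have hlim : Tendsto (fun t : ℝ => -(1 / (((m + 1 : ℕ) : ℝ) * Real.log t ^ (m + 1)))) atTop (𝓝 0) := by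
    have h1 : Tendsto (fun t : ℝ => ((m + 1 : ℕ) : ℝ) * Real.log t ^ (m + 1)) atTop atTop :=
      ((tendsto_pow_atTop (by omega)).comp Real.tendsto_log_atTop).const_mul_atTop
        (by exact_mod_cast Nat.succ_pos m)
    simpa using (tendsto_inv_atTop_zero.comp h1).neg
  have hpos : ∀ t ∈ Ioi x, 0 ≤ t⁻¹ / Real.log t ^ (m + 1 + 1) := by
    intro t ht
    have ht1 : 1 < t := hx.trans ht
    have hl : 0 < Real.log t := Real.log_pos ht1
    have ht0 : 0 < t := by linarith
    exact div_nonneg (inv_nonneg.mpr ht0.le) (pow_nonneg hl.le _)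
  have hcont : ContinuousWithinAt (fun t : ℝ => -(1 / (((m + 1 : ℕ) : ℝ) * Real.log t ^ (m + 1)))) (Ici x) x :=
    (hderiv x Set.self_mem_Ici).continuousAt.continuousWithinAt
  have hint : IntegrableOn (fun t : ℝ => t⁻¹ / Real.log t ^ (m + 1 + 1)) (Ioi x) :=
    integrableOn_Ioi_deriv_of_nonneg hcont (fun t ht => hderiv t (Set.mem_Ici.mpr (le_of_lt ht))) hpos hlim
  refine ⟨hint, ?_⟩
  rw [integral_Ioi_of_hasDerivAt_of_tendsto hcont (fun t ht => hderiv t (Set.mem_Ici.mpr (le_of_lt ht))) hint hlim]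
  ring

/-- Tail bound: if `|ρ(t)| ≤ C/(log t)^j` on `t > x > 1` with `ρ` measurable, then
`|∫_x^∞ ρ(t) dt/(t (log t)^{i+1})| ≤ C/((i+j)(log x)^{i+j})` and the integrand is integrable
(`i + j ≥ 1`). [folklore] -/
theorem abs_integral_Ioi_le {ρ : ℝ → ℝ} (hρm : Measurable ρ) {x C : ℝ} (hx : 1 < x)
    {i j : ℕ} (hij : 1 ≤ i + j) (hρ : ∀ t, x < t → |ρ t| ≤ C / Real.log t ^ j) :
    IntegrableOn (fun t => ρ t * (t⁻¹ / Real.log t ^ (i + 1))) (Ioi x) ∧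
      |∫ t in Ioi x, ρ t * (t⁻¹ / Real.log t ^ (i + 1))| ≤ C / ((i + j : ℕ) * Real.log x ^ (i + j)) := by
  obtain ⟨hint, hval⟩ := integral_Ioi_inv_div_log_pow hx hij
  have hdom : ∀ t ∈ Ioi x, ‖ρ t * (t⁻¹ / Real.log t ^ (i + 1))‖ ≤ C * (t⁻¹ / Real.log t ^ (i + j + 1)) := by
    intro t ht
    have ht1 : 1 < t := hx.trans ht
    have hl : 0 < Real.log t := Real.log_pos ht1
    have ht0 : 0 < t := by linarith
    have hw : 0 ≤ t⁻¹ / Real.log t ^ (i + 1) := div_nonneg (inv_nonneg.mpr ht0.le) (pow_nonneg hl.le _)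
    rw [norm_mul, Real.norm_eq_abs, Real.norm_eq_abs, abs_of_nonneg hw]
    calc |ρ t| * (t⁻¹ / Real.log t ^ (i + 1)) ≤ C / Real.log t ^ j * (t⁻¹ / Real.log t ^ (i + 1)) :=
          mul_le_mul_of_nonneg_right (hρ t ht) hw
      _ = C * (t⁻¹ / Real.log t ^ (i + j + 1)) := by
          rw [show i + j + 1 = j + (i + 1) by ring, pow_add]; field_simp; ring
  have hI : IntegrableOn (fun t => ρ t * (t⁻¹ / Real.log t ^ (i + 1))) (Ioi x) := by
    refine Integrable.mono' (hint.const_mul C)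
      ((hρm.mul (measurable_inv.div (Real.measurable_log.pow_const _))).aestronglyMeasurable) ?_
    rw [ae_restrict_iff' measurableSet_Ioi]
    exact Eventually.of_forall hdom
  refine ⟨hI, ?_⟩
  calc |∫ t in Ioi x, ρ t * (t⁻¹ / Real.log t ^ (i + 1))|
      = ‖∫ t in Ioi x, ρ t * (t⁻¹ / Real.log t ^ (i + 1))‖ := (Real.norm_eq_abs _).symm
    _ ≤ ∫ t in Ioi x, ‖ρ t * (t⁻¹ / Real.log t ^ (i + 1))‖ := norm_integral_le_integral_norm _
    _ ≤ ∫ t in Ioi x, C * (t⁻¹ / Real.log t ^ (i + j + 1)) := by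
        refine setIntegral_mono_on hI.norm (hint.const_mul C) measurableSet_Ioi hdom
    _ = C / ((i + j : ℕ) * Real.log x ^ (i + j)) := by
        rw [integral_const_mul, hval]; ring

/-- **Abel summation, first step**: for `x ≥ 2` and any weight `b`,
`Σ_{p ≤ x} b(p) log p / p = Θ_b(x)/x + ∫_2^x Θ_b(t) t⁻² dt`, `Θ_b(t) = Σ_{p ≤ t} b(p) log p`.
[folklore] -/
theorem sum_mul_log_div_eq (b : ℕ → ℝ) {x : ℝ} (hx : 2 ≤ x) :
    ∑ p ∈ Nat.primesLE ⌊x⌋₊, b p * Real.log p / p =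
      (∑ p ∈ Nat.primesLE ⌊x⌋₊, b p * Real.log p) / x +
        ∫ t in Ioc 2 x, (∑ p ∈ Nat.primesLE ⌊t⌋₊, b p * Real.log p) * (t⁻¹) ^ 2 := by
  set c : ℕ → ℝ := fun k => if k.Prime then b k * Real.log k else 0 with hc
  set f : ℝ → ℝ := fun t => t⁻¹ with hf
  set g : ℝ → ℝ := fun t => -(t⁻¹) ^ 2 with hg
  have hderiv : ∀ t : ℝ, 1 < t → HasDerivAt f (g t) t := fun t ht => by
    have ht0 : t ≠ 0 := by linarith
    simpa [hf, hg] using hasDerivAt_inv ht0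
  have hmem : ∀ t ∈ Set.Icc 2 x, t ∈ ({0}ᶜ : Set ℝ) := fun t ht =>
    Set.mem_compl_singleton_iff.mpr (show (0 : ℝ) < t by linarith [ht.1]).ne'
  have hgcont : ContinuousOn g (Set.Icc 2 x) := ((continuousOn_inv₀.mono hmem).pow 2).neg
  have hf_diff : ∀ t ∈ Set.Icc 2 x, DifferentiableAt ℝ f t := fun t ht =>
    (hderiv t (by linarith [ht.1])).differentiableAt
  have hderiv_eq : Set.EqOn g (deriv f) (Set.Icc 2 x) := fun t ht =>
    ((hderiv t (by linarith [ht.1])).deriv).symm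
  have hg_int : IntegrableOn g (Set.Icc 2 x) := hgcont.integrableOn_Icc
  have hf_int : IntegrableOn (deriv f) (Set.Icc 2 x) := hg_int.congr_fun hderiv_eq measurableSet_Icc
  have habel := sum_mul_eq_sub_sub_integral_mul c (by norm_num : (0 : ℝ) ≤ 2) hx hf_diff hf_int
  -- partial sums of `c` are `Θ_b`
  have hS : ∀ t : ℝ, ∑ k ∈ Icc 0 ⌊t⌋₊, c k = ∑ p ∈ Nat.primesLE ⌊t⌋₊, b p * Real.log p := by
    intro t
    rw [Nat.primesLE, Nat.primesBelow, Finset.sum_filter, Finset.range_eq_Ico, ← Finset.Ico_succ_right_eq_Icc]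
    rfl
  have hfl2 : ⌊(2 : ℝ)⌋₊ = 2 := by norm_num
  have hfc : ∀ k : ℕ, f k * c k = if k.Prime then b k * Real.log k / k else 0 := by
    intro k; simp only [hf, hc]; split_ifs <;> ring
  have hsum : ∀ n : ℕ, ∑ k ∈ Ioc 0 n, f k * c k = ∑ p ∈ Nat.primesLE n, b p * Real.log p / p := by
    intro n
    rw [Nat.primesLE_eq_filter_Ioc_zero, Finset.sum_filter]
    exact Finset.sum_congr rfl fun k _ => hfc k
  have hx2 : 2 ≤ ⌊x⌋₊ := Nat.le_floor (by simpa using hx)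
  have hlhs : ∑ k ∈ Ioc ⌊(2 : ℝ)⌋₊ ⌊x⌋₊, f k * c k =
      ∑ p ∈ Nat.primesLE ⌊x⌋₊, b p * Real.log p / p - b 2 * Real.log 2 / 2 := by
    rw [hfl2, ← hsum, eq_sub_iff_add_eq, add_comm, (Finset.sum_Ioc_consecutive _ (Nat.zero_le 2) hx2).symm]
    congr 1
    rw [show Finset.Ioc 0 2 = {1, 2} by decide, Finset.sum_pair (by norm_num), hfc, hfc]
    norm_num [Nat.prime_two, Nat.not_prime_one]
  have hb2 : f 2 * ∑ k ∈ Icc 0 ⌊(2 : ℝ)⌋₊, c k = b 2 * Real.log 2 / 2 := by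
    rw [hS, hfl2, Literature.NumberTheory.LFunctions.Mertens.primesLE_two, Finset.sum_singleton, hf]
    push_cast; ring
  have hbx : f x * ∑ k ∈ Icc 0 ⌊x⌋₊, c k = (∑ p ∈ Nat.primesLE ⌊x⌋₊, b p * Real.log p) / x := by
    rw [hS, hf]; ring
  have hint : ∫ t in Set.Ioc 2 x, deriv f t * ∑ k ∈ Icc 0 ⌊t⌋₊, c k =
      -∫ t in Ioc 2 x, (∑ p ∈ Nat.primesLE ⌊t⌋₊, b p * Real.log p) * (t⁻¹) ^ 2 := by
    rw [← integral_neg]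
    refine setIntegral_congr_fun measurableSet_Ioc fun t ht => ?_
    rw [← hderiv_eq (Set.Ioc_subset_Icc_self ht), hS, hg]
    ring
  rw [hlhs, hb2, hbx, hint] at habel
  linarith

/-- **Abel summation, second step**: for `x ≥ 2`,
`Σ_{p ≤ x} b(p)/p = S_b(x)/log x + ∫_2^x S_b(t) dt/(t log² t)`, `S_b(t) = Σ_{p ≤ t} b(p) log p/p`.
[folklore] -/
theorem sum_div_eq (b : ℕ → ℝ) {x : ℝ} (hx : 2 ≤ x) :
    ∑ p ∈ Nat.primesLE ⌊x⌋₊, b p / p =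
      (∑ p ∈ Nat.primesLE ⌊x⌋₊, b p * Real.log p / p) / Real.log x +
        ∫ t in Ioc 2 x, (∑ p ∈ Nat.primesLE ⌊t⌋₊, b p * Real.log p / p) * (t⁻¹ / Real.log t ^ 2) := by
  set c : ℕ → ℝ := fun k => if k.Prime then b k * Real.log k / k else 0 with hc
  set f : ℝ → ℝ := fun t => (Real.log t)⁻¹ with hf
  set g : ℝ → ℝ := fun t => -t⁻¹ / Real.log t ^ 2 with hg
  have hderiv : ∀ t : ℝ, 1 < t → HasDerivAt f (g t) t := fun t ht =>
    (Real.hasDerivAt_log (show t ≠ 0 by linarith)).inv (Real.log_pos ht).ne'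
  have hmem : ∀ t ∈ Set.Icc 2 x, t ∈ ({0}ᶜ : Set ℝ) := fun t ht =>
    Set.mem_compl_singleton_iff.mpr (show (0 : ℝ) < t by linarith [ht.1]).ne'
  have hlogne : ∀ t ∈ Set.Icc 2 x, Real.log t ≠ 0 := fun t ht => (Real.log_pos (by linarith [ht.1])).ne'
  have hgcont : ContinuousOn g (Set.Icc 2 x) :=
    ContinuousOn.div (ContinuousOn.neg (continuousOn_inv₀.mono hmem))
      ((Real.continuousOn_log.mono hmem).pow 2) fun t ht => pow_ne_zero _ (hlogne t ht)
  have hf_diff : ∀ t ∈ Set.Icc 2 x, DifferentiableAt ℝ f t := fun t ht =>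
    (hderiv t (by linarith [ht.1])).differentiableAt
  have hderiv_eq : Set.EqOn g (deriv f) (Set.Icc 2 x) := fun t ht =>
    ((hderiv t (by linarith [ht.1])).deriv).symm
  have hg_int : IntegrableOn g (Set.Icc 2 x) := hgcont.integrableOn_Icc
  have hf_int : IntegrableOn (deriv f) (Set.Icc 2 x) := hg_int.congr_fun hderiv_eq measurableSet_Icc
  have habel := sum_mul_eq_sub_sub_integral_mul c (by norm_num : (0 : ℝ) ≤ 2) hx hf_diff hf_int
  have hS : ∀ t : ℝ, ∑ k ∈ Icc 0 ⌊t⌋₊, c k = ∑ p ∈ Nat.primesLE ⌊t⌋₊, b p * Real.log p / p := by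
    intro t
    rw [Nat.primesLE, Nat.primesBelow, Finset.sum_filter, Finset.range_eq_Ico, ← Finset.Ico_succ_right_eq_Icc]
    rfl
  have hfl2 : ⌊(2 : ℝ)⌋₊ = 2 := by norm_num
  have hfc : ∀ k : ℕ, f k * c k = if k.Prime then b k / k else 0 := by
    intro k
    simp only [hf, hc]
    split_ifs with hk
    · have hk1 : (1 : ℝ) < k := by exact_mod_cast hk.one_lt
      have : Real.log k ≠ 0 := (Real.log_pos hk1).ne'
      field_simp
    · simp
  have hsum : ∀ n : ℕ, ∑ k ∈ Ioc 0 n, f k * c k = ∑ p ∈ Nat.primesLE n, b p / p := by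
    intro n
    rw [Nat.primesLE_eq_filter_Ioc_zero, Finset.sum_filter]
    exact Finset.sum_congr rfl fun k _ => hfc k
  have hx2 : 2 ≤ ⌊x⌋₊ := Nat.le_floor (by simpa using hx)
  have hlhs : ∑ k ∈ Ioc ⌊(2 : ℝ)⌋₊ ⌊x⌋₊, f k * c k = ∑ p ∈ Nat.primesLE ⌊x⌋₊, b p / p - b 2 / 2 := by
    rw [hfl2, ← hsum, eq_sub_iff_add_eq, add_comm, (Finset.sum_Ioc_consecutive _ (Nat.zero_le 2) hx2).symm]
    congr 1
    rw [show Finset.Ioc 0 2 = {1, 2} by decide, Finset.sum_pair (by norm_num), hfc, hfc]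
    norm_num [Nat.prime_two, Nat.not_prime_one]
  have hb2 : f 2 * ∑ k ∈ Icc 0 ⌊(2 : ℝ)⌋₊, c k = b 2 / 2 := by
    rw [hS, hfl2, Literature.NumberTheory.LFunctions.Mertens.primesLE_two, Finset.sum_singleton, hf]
    have : Real.log 2 ≠ 0 := (Real.log_pos (by norm_num)).ne'
    push_cast
    field_simp
  have hbx : f x * ∑ k ∈ Icc 0 ⌊x⌋₊, c k =
      (∑ p ∈ Nat.primesLE ⌊x⌋₊, b p * Real.log p / p) / Real.log x := by
    rw [hS, hf]; ring
  have hint : ∫ t in Set.Ioc 2 x, deriv f t * ∑ k ∈ Icc 0 ⌊t⌋₊, c k =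
      -∫ t in Ioc 2 x, (∑ p ∈ Nat.primesLE ⌊t⌋₊, b p * Real.log p / p) * (t⁻¹ / Real.log t ^ 2) := by
    rw [← integral_neg]
    refine setIntegral_congr_fun measurableSet_Ioc fun t ht => ?_
    rw [← hderiv_eq (Set.Ioc_subset_Icc_self ht), hS, hg]
    ring
  rw [hlhs, hb2, hbx, hint] at habel
  linarith


/-! ### Splitting `∫_{(2,x]} = ∫_{(2,∞)} - ∫_{(x,∞)}` -/

/-- For `f` integrable on `(2, ∞)` and `x ≥ 2`: `∫_{(2,x]} f = ∫_{(2,∞)} f - ∫_{(x,∞)} f`. [folklore] -/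
theorem setIntegral_Ioc_eq_sub {f : ℝ → ℝ} {x : ℝ} (hx : 2 ≤ x) (hf : IntegrableOn f (Set.Ioi 2)) :
    ∫ t in Set.Ioc 2 x, f t = (∫ t in Set.Ioi 2, f t) - ∫ t in Set.Ioi x, f t := by
  have hu : Set.Ioc 2 x ∪ Set.Ioi x = Set.Ioi 2 := Set.Ioc_union_Ioi_eq_Ioi hx
  have hd : Disjoint (Set.Ioc 2 x) (Set.Ioi x) := by
    rw [Set.disjoint_left]
    intro t h1 h2
    exact absurd h1.2 (not_le.mpr h2)
  have h1 : IntegrableOn f (Set.Ioc 2 x) := hf.mono_set (by rw [← hu]; exact Set.subset_union_left)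
  have h2 : IntegrableOn f (Set.Ioi x) := hf.mono_set (by rw [← hu]; exact Set.subset_union_right)
  rw [← hu, setIntegral_union hd measurableSet_Ioi h1 h2]
  ring

/-- **Mertens' first theorem with a log-power rate, weighted**: if `|b| ≤ 1` and
`|Θ_b(t) - m t| ≤ C t/(log t)^{12}` for `t ≥ 2`, then for some constant `c`,
`|Σ_{p ≤ x} b(p) log p/p - m log x - c| ≤ (C/log 2 + C/11)/(log x)^{11}` for `x ≥ 2`. [folklore] -/
theorem mertensI_of_chebyshev (b : ℕ → ℝ) {m C : ℝ}
    (hΘ : ∀ t : ℝ, 2 ≤ t → |(∑ p ∈ Nat.primesLE ⌊t⌋₊, b p * Real.log p) - m * t| ≤ C * t / Real.log t ^ 12) :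
    ∃ c : ℝ, ∀ x : ℝ, 2 ≤ x →
      |(∑ p ∈ Nat.primesLE ⌊x⌋₊, b p * Real.log p / p) - m * Real.log x - c| ≤
        (C / Real.log 2 + C / 11) / Real.log x ^ 11 := by
  set Θ : ℝ → ℝ := fun t => ∑ p ∈ Nat.primesLE ⌊t⌋₊, b p * Real.log p with hΘdef
  set E : ℝ → ℝ := fun t => Θ t - m * t with hE
  -- `ρ₁(t) = E(t) log t / t`, `|ρ₁| ≤ C/(log t)^{11}` for `t ≥ 2`
  set ρ : ℝ → ℝ := fun t => E t * Real.log t / t with hρ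
  have hC : 0 ≤ C := by
    have h := hΘ 2 le_rfl
    have h2 : 0 < (2 : ℝ) / Real.log 2 ^ 12 := by positivity
    have : 0 ≤ C * 2 / Real.log 2 ^ 12 := (abs_nonneg _).trans h
    rw [mul_div_assoc] at this
    exact nonneg_of_mul_nonneg_left this h2 |> fun h => by nlinarith [this, h2]
  have hρm : Measurable ρ :=
    (((measurable_primeSum _).sub (measurable_const.mul measurable_id)).mul Real.measurable_log).div
      measurable_id
  have hρb : ∀ t, 2 ≤ t → |ρ t| ≤ C / Real.log t ^ 11 := by
    intro t ht
    have ht0 : 0 < t := by linarith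
    have hl : 0 < Real.log t := Real.log_pos (by linarith)
    rw [hρ]
    simp only
    rw [abs_div, abs_mul, abs_of_pos ht0, abs_of_pos hl, div_le_div_iff₀ ht0 (pow_pos hl 11)]
    have h := hΘ t ht
    rw [le_div_iff₀ (pow_pos hl 12)] at h
    calc |E t| * Real.log t * Real.log t ^ 11 = |E t| * Real.log t ^ 12 := by ring
      _ = |Θ t - m * t| * Real.log t ^ 12 := rfl
      _ ≤ C * t := h
  -- the tail integrals
  have htail : ∀ x : ℝ, 2 ≤ x → IntegrableOn (fun t => ρ t * (t⁻¹ / Real.log t ^ (0 + 1))) (Ioi x) ∧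
      |∫ t in Ioi x, ρ t * (t⁻¹ / Real.log t ^ (0 + 1))| ≤ C / ((0 + 11 : ℕ) * Real.log x ^ (0 + 11)) :=
    fun x hx => abs_integral_Ioi_le hρm (by linarith) (by norm_num) fun t ht => hρb t (by linarith)
  -- `ρ(t) (t⁻¹/log t) = E(t) t⁻²` on `t > 1`
  have hρE : ∀ t : ℝ, 1 < t → ρ t * (t⁻¹ / Real.log t ^ (0 + 1)) = E t * (t⁻¹) ^ 2 := by
    intro t ht
    have ht0 : t ≠ 0 := by linarith
    have hl : Real.log t ≠ 0 := (Real.log_pos ht).ne'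
    rw [hρ]; simp only [zero_add, pow_one]; field_simp
  obtain ⟨hI2, -⟩ := htail 2 le_rfl
  refine ⟨m - m * Real.log 2 + ∫ t in Ioi 2, ρ t * (t⁻¹ / Real.log t ^ (0 + 1)), fun x hx => ?_⟩
  have hx0 : 0 < x := by linarith
  have hlx : 0 < Real.log x := Real.log_pos (by linarith)
  have hl2 : 0 < Real.log 2 := Real.log_pos (by norm_num)
  obtain ⟨hIx, hbx⟩ := htail x hx
  -- Abel
  rw [sum_mul_log_div_eq b hx]
  -- `∫_{(2,x]} Θ t⁻² = m (log x - log 2) + ∫_{(2,x]} E t⁻²`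
  have hsplit : ∫ t in Ioc 2 x, Θ t * (t⁻¹) ^ 2 =
      m * (Real.log x - Real.log 2) + ∫ t in Ioc 2 x, ρ t * (t⁻¹ / Real.log t ^ (0 + 1)) := by
    have hpt : ∀ t ∈ Ioc 2 x, Θ t * (t⁻¹) ^ 2 = m * t⁻¹ + ρ t * (t⁻¹ / Real.log t ^ (0 + 1)) := by
      intro t ht
      rw [hρE t (by linarith [ht.1]), hE]; simp only
      have ht0 : (t : ℝ) ≠ 0 := by linarith [ht.1]
      field_simp; ring
    have hi1 : IntegrableOn (fun t : ℝ => m * t⁻¹) (Ioc 2 x) := by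
      refine ((continuousOn_const.mul (continuousOn_inv₀.mono ?_)).integrableOn_Icc).mono_set Set.Ioc_subset_Icc_self
      intro t ht; exact Set.mem_compl_singleton_iff.mpr (show (0 : ℝ) < t by linarith [ht.1]).ne'
    have hi2 : IntegrableOn (fun t => ρ t * (t⁻¹ / Real.log t ^ (0 + 1))) (Ioc 2 x) :=
      hI2.mono_set Set.Ioc_subset_Ioi_self
    rw [setIntegral_congr_fun measurableSet_Ioc hpt, integral_add hi1 hi2, integral_const_mul]
    congr 1
    rw [← intervalIntegral.integral_of_le hx, integral_inv_of_pos two_pos hx0, Real.log_div hx0.ne' two_ne_zero]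
  rw [hsplit, setIntegral_Ioc_eq_sub hx hI2]
  -- `Θ(x)/x = m + E(x)/x`
  have hΘx : Θ x / x = m + E x / x := by rw [hE]; simp only; field_simp; ring
  have hfinal : Θ x / x + (m * (Real.log x - Real.log 2) +
      ((∫ t in Ioi 2, ρ t * (t⁻¹ / Real.log t ^ (0 + 1))) - ∫ t in Ioi x, ρ t * (t⁻¹ / Real.log t ^ (0 + 1)))) -
      m * Real.log x - (m - m * Real.log 2 + ∫ t in Ioi 2, ρ t * (t⁻¹ / Real.log t ^ (0 + 1))) =
      E x / x - ∫ t in Ioi x, ρ t * (t⁻¹ / Real.log t ^ (0 + 1)) := by rw [hΘx]; ring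
  change |Θ x / x + _ - _ - _| ≤ _
  rw [hfinal]
  refine (abs_sub _ _).trans ?_
  -- `|E(x)/x| ≤ C/(log x)^{12} ≤ (C/log 2)/(log x)^{11}`
  have h1 : |E x / x| ≤ C / Real.log 2 / Real.log x ^ 11 := by
    have h := hΘ x hx
    rw [abs_div, abs_of_pos hx0, div_le_iff₀ hx0]
    calc |E x| = |Θ x - m * x| := rfl
      _ ≤ C * x / Real.log x ^ 12 := h
      _ ≤ C / Real.log 2 / Real.log x ^ 11 * x := by
          rw [div_mul_eq_mul_div, div_le_div_iff₀ (pow_pos hlx 12) (pow_pos hlx 11)]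
          have hlog2x : Real.log 2 ≤ Real.log x := Real.log_le_log two_pos hx
          have : C * x * Real.log x ^ 11 * Real.log 2 ≤ C * x * Real.log x ^ 11 * Real.log x := by
            gcongr
          calc C * x * Real.log x ^ 11 = C / Real.log 2 * x * Real.log x ^ 11 * Real.log 2 := by field_simp
            _ ≤ C / Real.log 2 * x * Real.log x ^ 11 * Real.log x := by gcongr
            _ = C / Real.log 2 * x * Real.log x ^ 12 := by ring
  have h2 : |∫ t in Ioi x, ρ t * (t⁻¹ / Real.log t ^ (0 + 1))| ≤ C / 11 / Real.log x ^ 11 := by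
    refine hbx.trans (le_of_eq ?_)
    push_cast; ring
  calc |E x / x| + |∫ t in Ioi x, ρ t * (t⁻¹ / Real.log t ^ (0 + 1))|
      ≤ C / Real.log 2 / Real.log x ^ 11 + C / 11 / Real.log x ^ 11 := add_le_add h1 h2
    _ = (C / Real.log 2 + C / 11) / Real.log x ^ 11 := by ring


/-- `∫_{(2,x]} dt/(t log t) = log log x - log log 2` (`x ≥ 2`). [folklore] -/
theorem integral_inv_mul_log_inv {x : ℝ} (hx : 2 ≤ x) :
    ∫ t in Set.Ioc 2 x, t⁻¹ / Real.log t = Real.log (Real.log x) - Real.log (Real.log 2) := by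
  have hderiv : ∀ t : ℝ, 1 < t → HasDerivAt (fun t => Real.log (Real.log t)) (t⁻¹ / Real.log t) t := by
    intro t ht
    have ht0 : t ≠ 0 := (zero_lt_one.trans ht).ne'
    exact (Real.hasDerivAt_log ht0).log (Real.log_pos ht).ne'
  rw [← intervalIntegral.integral_of_le hx]
  refine intervalIntegral.integral_eq_sub_of_hasDerivAt (fun t ht => hderiv t ?_)
    ((Literature.NumberTheory.LFunctions.Mertens.continuousOn_inv_div_log x).mono ?_).intervalIntegrable
  · rw [Set.uIcc_of_le hx] at ht; linarith [ht.1]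
  · rw [Set.uIcc_of_le hx]

/-- **Mertens' second theorem with a log-power rate, weighted**: if
`|S_b(t) - m log t - c| ≤ C'/(log t)^{11}` for `t ≥ 2` (`S_b(t) = Σ_{p ≤ t} b(p) log p/p`), then
for some constant `C₀`, `|Σ_{p ≤ x} b(p)/p - m log log x - C₀| ≤ (C' + C'/12)/(log x)^{12}` for
`x ≥ 2`. [folklore] -/
theorem mertensII_of_mertensI (b : ℕ → ℝ) {m c C' : ℝ}
    (hS : ∀ t : ℝ, 2 ≤ t →
      |(∑ p ∈ Nat.primesLE ⌊t⌋₊, b p * Real.log p / p) - m * Real.log t - c| ≤ C' / Real.log t ^ 11) :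
    ∃ C₀ : ℝ, ∀ x : ℝ, 2 ≤ x →
      |(∑ p ∈ Nat.primesLE ⌊x⌋₊, b p / p) - m * Real.log (Real.log x) - C₀| ≤
        (C' + C' / 12) / Real.log x ^ 12 := by
  set S : ℝ → ℝ := fun t => ∑ p ∈ Nat.primesLE ⌊t⌋₊, b p * Real.log p / p with hSdef
  set ρ : ℝ → ℝ := fun t => S t - m * Real.log t - c with hρ
  have hl2 : 0 < Real.log 2 := Real.log_pos (by norm_num)
  have hC' : 0 ≤ C' := by
    have h := hS 2 le_rfl
    have : 0 ≤ C' / Real.log 2 ^ 11 := (abs_nonneg _).trans h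
    exact (div_nonneg_iff.mp this).elim (fun h => h.1) fun h => by
      have := h.2; have h11 := pow_pos hl2 11; linarith
  have hρm : Measurable ρ :=
    ((measurable_primeSum _).sub (measurable_const.mul Real.measurable_log)).sub measurable_const
  have hρb : ∀ t, 2 ≤ t → |ρ t| ≤ C' / Real.log t ^ 11 := fun t ht => hS t ht
  have htail : ∀ x : ℝ, 2 ≤ x → IntegrableOn (fun t => ρ t * (t⁻¹ / Real.log t ^ (1 + 1))) (Set.Ioi x) ∧
      |∫ t in Set.Ioi x, ρ t * (t⁻¹ / Real.log t ^ (1 + 1))| ≤ C' / ((1 + 11 : ℕ) * Real.log x ^ (1 + 11)) :=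
    fun x hx => abs_integral_Ioi_le hρm (by linarith) (by norm_num) fun t ht => hρb t (by linarith)
  obtain ⟨hI2, -⟩ := htail 2 le_rfl
  -- the weight `w(t) = t⁻¹ / log² t` on `(2, ∞)`
  obtain ⟨hw2, hw2v⟩ := integral_Ioi_inv_div_log_pow (show (1 : ℝ) < 2 by norm_num) le_rfl
  refine ⟨m - m * Real.log (Real.log 2) + c / Real.log 2 + ∫ t in Set.Ioi 2, ρ t * (t⁻¹ / Real.log t ^ (1 + 1)),
    fun x hx => ?_⟩
  have hx0 : 0 < x := by linarith
  have hx1 : 1 < x := by linarith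
  have hlx : 0 < Real.log x := Real.log_pos hx1
  obtain ⟨hIx, hbx⟩ := htail x hx
  obtain ⟨hwx, hwxv⟩ := integral_Ioi_inv_div_log_pow hx1 le_rfl
  rw [sum_div_eq b hx]
  -- `∫_{(2,x]} S w = m (loglog x - loglog 2) + c (1/log 2 - 1/log x) + ∫_{(2,x]} ρ w`
  have hsplit : ∫ t in Set.Ioc 2 x, S t * (t⁻¹ / Real.log t ^ 2) =
      m * (Real.log (Real.log x) - Real.log (Real.log 2)) + c * (1 / Real.log 2 - 1 / Real.log x) +
        ∫ t in Set.Ioc 2 x, ρ t * (t⁻¹ / Real.log t ^ (1 + 1)) := by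
    have hpt : ∀ t ∈ Set.Ioc 2 x, S t * (t⁻¹ / Real.log t ^ 2) =
        (m * (t⁻¹ / Real.log t) + c * (t⁻¹ / Real.log t ^ (1 + 1))) + ρ t * (t⁻¹ / Real.log t ^ (1 + 1)) := by
      intro t ht
      have ht0 : (t : ℝ) ≠ 0 := by linarith [ht.1]
      have hl : Real.log t ≠ 0 := (Real.log_pos (by linarith [ht.1])).ne'
      rw [hρ]; simp only
      field_simp; ring
    have hmem : ∀ t ∈ Set.Icc 2 x, t ∈ ({0}ᶜ : Set ℝ) := fun t ht =>
      Set.mem_compl_singleton_iff.mpr (show (0 : ℝ) < t by linarith [ht.1]).ne'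
    have hi1 : IntegrableOn (fun t : ℝ => m * (t⁻¹ / Real.log t) + c * (t⁻¹ / Real.log t ^ (1 + 1))) (Set.Ioc 2 x) := by
      refine IntegrableOn.add ?_ ?_
      · exact ((continuousOn_const.mul (Literature.NumberTheory.LFunctions.Mertens.continuousOn_inv_div_log x)).integrableOn_Icc).mono_set
          Set.Ioc_subset_Icc_self
      · exact (hw2.mono_set Set.Ioc_subset_Ioi_self).const_mul c
    have hi2 : IntegrableOn (fun t => ρ t * (t⁻¹ / Real.log t ^ (1 + 1))) (Set.Ioc 2 x) :=
      hI2.mono_set Set.Ioc_subset_Ioi_self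
    rw [setIntegral_congr_fun measurableSet_Ioc hpt, integral_add hi1 hi2]
    congr 1
    have hi3 : IntegrableOn (fun t : ℝ => m * (t⁻¹ / Real.log t)) (Set.Ioc 2 x) :=
      ((continuousOn_const.mul (Literature.NumberTheory.LFunctions.Mertens.continuousOn_inv_div_log x)).integrableOn_Icc).mono_set
        Set.Ioc_subset_Icc_self
    have hi4 : IntegrableOn (fun t : ℝ => c * (t⁻¹ / Real.log t ^ (1 + 1))) (Set.Ioc 2 x) :=
      (hw2.mono_set Set.Ioc_subset_Ioi_self).const_mul c
    rw [integral_add hi3 hi4, integral_const_mul, integral_const_mul, integral_inv_mul_log_inv hx,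
      setIntegral_Ioc_eq_sub hx hw2, hw2v, hwxv]
    push_cast; ring
  rw [hsplit, setIntegral_Ioc_eq_sub hx hI2]
  have hSx : S x / Real.log x = m + (c + ρ x) / Real.log x := by
    rw [hρ]; simp only; field_simp; ring
  have hfinal : S x / Real.log x + (m * (Real.log (Real.log x) - Real.log (Real.log 2)) +
      c * (1 / Real.log 2 - 1 / Real.log x) +
      ((∫ t in Set.Ioi 2, ρ t * (t⁻¹ / Real.log t ^ (1 + 1))) - ∫ t in Set.Ioi x, ρ t * (t⁻¹ / Real.log t ^ (1 + 1)))) -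
      m * Real.log (Real.log x) -
      (m - m * Real.log (Real.log 2) + c / Real.log 2 + ∫ t in Set.Ioi 2, ρ t * (t⁻¹ / Real.log t ^ (1 + 1))) =
      ρ x / Real.log x - ∫ t in Set.Ioi x, ρ t * (t⁻¹ / Real.log t ^ (1 + 1)) := by
    rw [hSx]; field_simp; ring
  change |S x / Real.log x + _ - _ - _| ≤ _
  rw [hfinal]
  refine (abs_sub _ _).trans ?_
  have h1 : |ρ x / Real.log x| ≤ C' / Real.log x ^ 12 := by
    rw [abs_div, abs_of_pos hlx, div_le_div_iff₀ hlx (pow_pos hlx 12)]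
    have h := hρb x hx
    rw [le_div_iff₀ (pow_pos hlx 11)] at h
    calc |ρ x| * Real.log x ^ 12 = |ρ x| * Real.log x ^ 11 * Real.log x := by ring
      _ ≤ C' * Real.log x := mul_le_mul_of_nonneg_right h hlx.le
  have h2 : |∫ t in Set.Ioi x, ρ t * (t⁻¹ / Real.log t ^ (1 + 1))| ≤ C' / 12 / Real.log x ^ 12 := by
    refine hbx.trans (le_of_eq ?_)
    push_cast; ring
  calc |ρ x / Real.log x| + |∫ t in Set.Ioi x, ρ t * (t⁻¹ / Real.log t ^ (1 + 1))|
      ≤ C' / Real.log x ^ 12 + C' / 12 / Real.log x ^ 12 := add_le_add h1 h2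
    _ = (C' + C' / 12) / Real.log x ^ 12 := by ring


/-! ## Stage 2: the Chebyshev-type inputs for the weights `1` and `χ₄` from Siegel–Walfisz -/

/-- `χ₄(n) = [n ≡ 1 (4)] - [n ≡ 3 (4)]` as real numbers. [folklore] -/
theorem chi4_cast_eq_ite_sub (n : ℕ) :
    (ZMod.χ₄ n : ℝ) = (if (n : ZMod 4) = 1 then (1 : ℝ) else 0) - (if (n : ZMod 4) = 3 then 1 else 0) := by
  have e1 : ((n : ZMod 4) = 1) ↔ n % 4 = 1 := by
    rw [show (1 : ZMod 4) = ((1 : ℕ) : ZMod 4) by norm_cast, ZMod.natCast_eq_natCast_iff']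
  have e3 : ((n : ZMod 4) = 3) ↔ n % 4 = 3 := by
    rw [show (3 : ZMod 4) = ((3 : ℕ) : ZMod 4) by norm_cast, ZMod.natCast_eq_natCast_iff']
  rw [ZMod.χ₄_nat_eq_if_mod_four]
  simp only [e1, e3]
  have h2 : n % 2 = n % 4 % 2 := (Nat.mod_mod_of_dvd n (by norm_num : 2 ∣ 4)).symm
  rw [h2]
  have h4 : n % 4 < 4 := Nat.mod_lt _ (by norm_num)
  generalize n % 4 = r at h4 ⊢
  interval_cases r <;> simp

/-- `ψ(x; 4, 1) - ψ(x; 4, 3) = Σ_{n ≤ x} χ₄(n) Λ(n)`. [folklore] -/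
theorem psiMod_one_sub_three (x : ℝ) :
    ParityWave0.chebyshevPsiMod 4 (1 : ZMod 4) x - ParityWave0.chebyshevPsiMod 4 (3 : ZMod 4) x =
      ∑ n ∈ Finset.range (⌊x⌋₊ + 1), (ZMod.χ₄ n : ℝ) * ArithmeticFunction.vonMangoldt n := by
  unfold ParityWave0.chebyshevPsiMod
  rw [← Finset.sum_sub_distrib]
  refine Finset.sum_congr rfl fun n _ => ?_
  rw [chi4_cast_eq_ite_sub]
  simp only [ArithmeticFunction.vonMangoldt.residueClass, Set.indicator_apply, Set.mem_setOf_eq]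
  split_ifs <;> simp

/-- The prime-power error: `|Σ_{n ≤ x} χ₄(n)Λ(n) - Σ_{p ≤ x} χ₄(p) log p| ≤ ψ(x) - θ(x)`. [folklore] -/
theorem abs_sum_chi4_vonMangoldt_sub_le (x : ℝ) :
    |(∑ n ∈ Finset.range (⌊x⌋₊ + 1), (ZMod.χ₄ n : ℝ) * ArithmeticFunction.vonMangoldt n) -
      ∑ p ∈ Nat.primesLE ⌊x⌋₊, (ZMod.χ₄ p : ℝ) * Real.log p| ≤ ψ x - θ x := by
  have h0 : ∑ n ∈ Finset.range (⌊x⌋₊ + 1), (ZMod.χ₄ n : ℝ) * ArithmeticFunction.vonMangoldt n =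
      ∑ n ∈ Finset.Ioc 0 ⌊x⌋₊, (ZMod.χ₄ n : ℝ) * ArithmeticFunction.vonMangoldt n := by
    rw [Nat.range_succ_eq_Icc_zero, Finset.Icc_eq_cons_Ioc (Nat.zero_le _), Finset.sum_cons]
    simp
  have h1 : ∑ p ∈ Nat.primesLE ⌊x⌋₊, (ZMod.χ₄ p : ℝ) * Real.log p =
      ∑ n ∈ (Finset.Ioc 0 ⌊x⌋₊).filter Nat.Prime, (ZMod.χ₄ n : ℝ) * ArithmeticFunction.vonMangoldt n := by
    rw [Nat.primesLE_eq_filter_Ioc_zero]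
    refine Finset.sum_congr rfl fun p hp => ?_
    rw [ArithmeticFunction.vonMangoldt_apply_prime (Finset.mem_filter.mp hp).2]
  rw [h0, h1, ← Finset.sum_filter_add_sum_filter_not (Finset.Ioc 0 ⌊x⌋₊) Nat.Prime, add_sub_cancel_left,
    Chebyshev.psi_sub_theta_eq_sum_not_prime]
  refine (Finset.abs_sum_le_sum_abs _ _).trans (Finset.sum_le_sum fun n _ => ?_)
  rw [abs_mul, abs_of_nonneg ArithmeticFunction.vonMangoldt_nonneg]
  calc |(ZMod.χ₄ n : ℝ)| * ArithmeticFunction.vonMangoldt n ≤ 1 * ArithmeticFunction.vonMangoldt n := by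
        refine mul_le_mul_of_nonneg_right ?_ ArithmeticFunction.vonMangoldt_nonneg
        rw [chi4_cast_eq_ite_sub]; split_ifs <;> norm_num
    _ = _ := one_mul _

/-- `|χ₄(n)| ≤ 1`. [folklore] -/
theorem abs_chi4_cast_le (n : ℕ) : |(ZMod.χ₄ n : ℝ)| ≤ 1 := by
  rw [chi4_cast_eq_ite_sub]; split_ifs <;> norm_num

/-- `2 √x log x ≤ 2 · 26¹³ x/(log x)^{12}` for `x > 1` (from `log x ≤ 26 x^{1/26}`). [folklore] -/
theorem two_sqrt_mul_log_le {x : ℝ} (hx : 1 < x) :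
    2 * Real.sqrt x * Real.log x ≤ 2 * 26 ^ 13 * x / Real.log x ^ 12 := by
  have hx0 : 0 < x := by linarith
  have hl : 0 < Real.log x := Real.log_pos hx
  have h := Real.log_le_rpow_div hx0.le (by norm_num : (0 : ℝ) < 1 / 26)
  have h13 : Real.log x ^ 13 ≤ 26 ^ 13 * Real.sqrt x := by
    calc Real.log x ^ 13 ≤ (x ^ (1 / 26 : ℝ) / (1 / 26)) ^ 13 := by gcongr
      _ = 26 ^ 13 * (x ^ (1 / 26 : ℝ)) ^ 13 := by ring
      _ = 26 ^ 13 * Real.sqrt x := by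
          rw [← Real.rpow_natCast (x ^ (1 / 26 : ℝ)) 13, ← Real.rpow_mul hx0.le, Real.sqrt_eq_rpow]
          norm_num
  rw [le_div_iff₀ (pow_pos hl 12)]
  have hs : 0 ≤ Real.sqrt x := Real.sqrt_nonneg x
  have hsx : Real.sqrt x * Real.sqrt x = x := Real.mul_self_sqrt hx0.le
  nlinarith [mul_le_mul_of_nonneg_left h13 (by positivity : (0 : ℝ) ≤ 2 * Real.sqrt x)]

/-- `(log 4)^{12} ≥ 4`. [folklore] -/
theorem four_le_log_four_pow : (4 : ℝ) ≤ Real.log 4 ^ 12 := by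
  have h : (1.386 : ℝ) ≤ Real.log 4 := by
    have := Real.log_two_gt_d9
    rw [show (4 : ℝ) = 2 ^ 2 by norm_num, Real.log_pow]; push_cast; linarith
  calc (4 : ℝ) ≤ 1.386 ^ 12 := by norm_num
    _ ≤ Real.log 4 ^ 12 := by gcongr

/-- Uniformization on `[2, 4]`: a bound `|F(t)| ≤ K t` becomes `|F(t)| ≤ K (log 4)^{12} t/(log t)^{12}`
for `2 ≤ t ≤ 4`. [folklore] -/
theorem small_range_bound {F t K : ℝ} (hK : 0 ≤ K) (ht2 : 2 ≤ t) (ht4 : t ≤ 4) (h : |F| ≤ K * t) :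
    |F| ≤ K * Real.log 4 ^ 12 * t / Real.log t ^ 12 := by
  have hl : 0 < Real.log t := Real.log_pos (by linarith)
  have hl4 : Real.log t ≤ Real.log 4 := Real.log_le_log (by linarith) ht4
  rw [le_div_iff₀ (pow_pos hl 12)]
  have h12 : Real.log t ^ 12 ≤ Real.log 4 ^ 12 := by gcongr
  calc |F| * Real.log t ^ 12 ≤ K * t * Real.log 4 ^ 12 := mul_le_mul h h12 (by positivity) (by positivity)
    _ = K * Real.log 4 ^ 12 * t := by ring

/-- **The Chebyshev inputs from Siegel–Walfisz.** Assuming `siegel_walfisz` (parity.S28): there are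
constants `C₁, C₂` with, for all `t ≥ 2`,
`|θ(t) - t| ≤ C₁ t/(log t)^{12}` and `|Σ_{p ≤ t} χ₄(p) log p| ≤ C₂ t/(log t)^{12}`. [folklore] -/
theorem chebyshev_inputs_of_siegelWalfisz (hSW : siegel_walfisz) :
    ∃ C₁ C₂ : ℝ, (∀ t : ℝ, 2 ≤ t → |θ t - t| ≤ C₁ * t / Real.log t ^ 12) ∧
      (∀ t : ℝ, 2 ≤ t → |∑ p ∈ Nat.primesLE ⌊t⌋₊, (ZMod.χ₄ p : ℝ) * Real.log p| ≤ C₂ * t / Real.log t ^ 12) := by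
  obtain ⟨C₀, hC₀⟩ := hSW 12 (by norm_num)
  set C := max C₀ 0 with hC
  have hC0 : 0 ≤ C := le_max_right _ _
  -- the Siegel–Walfisz bounds for `t ≥ 4`, `q = 1` and `q = 4`
  have hpow : ∀ t : ℝ, Real.log t ^ (12 : ℝ) = Real.log t ^ (12 : ℕ) := fun t => by
    rw [show (12 : ℝ) = ((12 : ℕ) : ℝ) by norm_num, Real.rpow_natCast]
  have hq4 : ∀ t : ℝ, 4 ≤ t → ((4 : ℕ) : ℝ) ≤ Real.log t ^ (12 : ℝ) := by
    intro t ht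
    rw [hpow]
    calc ((4 : ℕ) : ℝ) = 4 := by norm_num
      _ ≤ Real.log 4 ^ 12 := four_le_log_four_pow
      _ ≤ Real.log t ^ 12 :=
          pow_le_pow_left₀ (Real.log_pos (by norm_num)).le (Real.log_le_log (by norm_num) ht) 12
  have hq1 : ∀ t : ℝ, 4 ≤ t → ((1 : ℕ) : ℝ) ≤ Real.log t ^ (12 : ℝ) := fun t ht =>
    le_trans (by norm_num) (hq4 t ht)
  set a₃ : (ZMod 4)ˣ := ⟨3, 3, by decide, by decide⟩ with ha₃
  have hψ : ∀ t : ℝ, 4 ≤ t → |ψ t - t| ≤ C * t / Real.log t ^ 12 := by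
    intro t ht
    have h := hC₀ t (by linarith) 1 le_rfl (hq1 t ht) 1
    rw [show ((1 : (ZMod 1)ˣ) : ZMod 1) = (1 : ZMod 1) from rfl, ParityWave0.chebyshevPsiMod_one, Nat.totient_one,
      Nat.cast_one, div_one, hpow] at h
    refine h.trans ?_
    have hl : 0 ≤ Real.log t := (Real.log_pos (by linarith)).le
    exact div_le_div_of_nonneg_right (mul_le_mul_of_nonneg_right (le_max_left _ _) (by linarith))
      (pow_nonneg hl _)
  have hψ4 : ∀ t : ℝ, 4 ≤ t → ∀ a : (ZMod 4)ˣ, |ParityWave0.chebyshevPsiMod 4 a t - t / 2| ≤ C * t / Real.log t ^ 12 := by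
    intro t ht a
    have h := hC₀ t (by linarith) 4 (by norm_num) (hq4 t ht) a
    rw [show Nat.totient 4 = 2 by decide, hpow] at h
    push_cast at h
    refine h.trans ?_
    have hl : 0 ≤ Real.log t := (Real.log_pos (by linarith)).le
    exact div_le_div_of_nonneg_right (mul_le_mul_of_nonneg_right (le_max_left _ _) (by linarith))
      (pow_nonneg hl _)
  refine ⟨C + 2 * 26 ^ 13 + (Real.log 4 + 1) * Real.log 4 ^ 12,
    2 * C + 2 * 26 ^ 13 + Real.log 4 * Real.log 4 ^ 12, fun t ht => ?_, fun t ht => ?_⟩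
  · -- `θ`
    have ht0 : 0 < t := by linarith
    have hl : 0 < Real.log t := Real.log_pos (by linarith)
    have hunit : 0 ≤ t / Real.log t ^ 12 := by positivity
    rcases le_or_gt t 4 with h4 | h4
    · have hb : |θ t - t| ≤ (Real.log 4 + 1) * t := by
        have hl4 : 0 ≤ Real.log 4 := Real.log_nonneg (by norm_num)
        rw [abs_le]
        constructor
        · nlinarith [Chebyshev.theta_nonneg t]
        · linarith [Chebyshev.theta_le_log4_mul_x ht0.le]
      have := small_range_bound (by positivity) ht h4 hb
      calc |θ t - t| ≤ (Real.log 4 + 1) * Real.log 4 ^ 12 * t / Real.log t ^ 12 := this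
        _ ≤ (C + 2 * 26 ^ 13 + (Real.log 4 + 1) * Real.log 4 ^ 12) * t / Real.log t ^ 12 := by
            rw [mul_div_assoc, mul_div_assoc]
            refine mul_le_mul_of_nonneg_right ?_ hunit
            linarith [hC0]
    · have h1 := hψ t h4.le
      have h2 : ψ t - θ t ≤ 2 * Real.sqrt t * Real.log t := Chebyshev.psi_sub_theta_le (by linarith)
      have h3 := two_sqrt_mul_log_le (show (1 : ℝ) < t by linarith)
      have h5 : 0 ≤ ψ t - θ t := by linarith [Chebyshev.theta_le_psi t]
      calc |θ t - t| = |(ψ t - t) - (ψ t - θ t)| := by ring_nf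
        _ ≤ |ψ t - t| + |ψ t - θ t| := abs_sub _ _
        _ ≤ C * t / Real.log t ^ 12 + 2 * 26 ^ 13 * t / Real.log t ^ 12 := by
            rw [abs_of_nonneg h5]; exact add_le_add h1 (h2.trans h3)
        _ ≤ (C + 2 * 26 ^ 13 + (Real.log 4 + 1) * Real.log 4 ^ 12) * t / Real.log t ^ 12 := by
            rw [← add_div, ← add_mul, mul_div_assoc, mul_div_assoc]
            refine mul_le_mul_of_nonneg_right ?_ hunit
            have : 0 ≤ (Real.log 4 + 1) * Real.log 4 ^ 12 := by
              have := Real.log_pos (show (1 : ℝ) < 4 by norm_num); positivity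
            linarith
  · -- `χ₄`
    have ht0 : 0 < t := by linarith
    have hl : 0 < Real.log t := Real.log_pos (by linarith)
    have hunit : 0 ≤ t / Real.log t ^ 12 := by positivity
    rcases le_or_gt t 4 with h4 | h4
    · have hb : |∑ p ∈ Nat.primesLE ⌊t⌋₊, (ZMod.χ₄ p : ℝ) * Real.log p| ≤ Real.log 4 * t :=
        abs_sum_mul_log_le abs_chi4_cast_le ht0.le
      have := small_range_bound (Real.log_pos (by norm_num : (1 : ℝ) < 4)).le ht h4 hb
      refine this.trans ?_
      rw [mul_div_assoc, mul_div_assoc]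
      refine mul_le_mul_of_nonneg_right ?_ hunit
      have : (0 : ℝ) ≤ 2 * 26 ^ 13 := by positivity
      linarith [hC0]
    · have h1 := hψ4 t h4.le 1
      have h3' := hψ4 t h4.le a₃
      have ha : ((a₃ : (ZMod 4)ˣ) : ZMod 4) = 3 := rfl
      rw [ha] at h3'
      rw [show ((1 : (ZMod 4)ˣ) : ZMod 4) = (1 : ZMod 4) from rfl] at h1
      have hdiff := psiMod_one_sub_three t
      have hpp := abs_sum_chi4_vonMangoldt_sub_le t
      have h2 : ψ t - θ t ≤ 2 * Real.sqrt t * Real.log t := Chebyshev.psi_sub_theta_le (by linarith)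
      have h3 := two_sqrt_mul_log_le (show (1 : ℝ) < t by linarith)
      -- triangle inequality
      have key : |∑ p ∈ Nat.primesLE ⌊t⌋₊, (ZMod.χ₄ p : ℝ) * Real.log p| ≤
          |ParityWave0.chebyshevPsiMod 4 1 t - t / 2| + |ParityWave0.chebyshevPsiMod 4 3 t - t / 2| + (ψ t - θ t) := by
        have e : ∑ p ∈ Nat.primesLE ⌊t⌋₊, (ZMod.χ₄ p : ℝ) * Real.log p =
            (ParityWave0.chebyshevPsiMod 4 1 t - t / 2) - (ParityWave0.chebyshevPsiMod 4 3 t - t / 2) -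
            ((∑ n ∈ Finset.range (⌊t⌋₊ + 1), (ZMod.χ₄ n : ℝ) * ArithmeticFunction.vonMangoldt n) -
              ∑ p ∈ Nat.primesLE ⌊t⌋₊, (ZMod.χ₄ p : ℝ) * Real.log p) := by
          rw [← hdiff]; ring
        rw [e]
        refine (abs_sub _ _).trans (add_le_add (abs_sub _ _) hpp)
      calc |∑ p ∈ Nat.primesLE ⌊t⌋₊, (ZMod.χ₄ p : ℝ) * Real.log p|
          ≤ C * t / Real.log t ^ 12 + C * t / Real.log t ^ 12 + 2 * 26 ^ 13 * t / Real.log t ^ 12 :=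
            key.trans (add_le_add (add_le_add h1 h3') (h2.trans h3))
        _ ≤ (2 * C + 2 * 26 ^ 13 + Real.log 4 * Real.log 4 ^ 12) * t / Real.log t ^ 12 := by
            rw [← add_div, ← add_div, ← add_mul, ← add_mul, mul_div_assoc, mul_div_assoc]
            refine mul_le_mul_of_nonneg_right ?_ hunit
            have : 0 ≤ Real.log 4 * Real.log 4 ^ 12 := by
              have := Real.log_pos (show (1 : ℝ) < 4 by norm_num); positivity
            linarith


/-! ## Stage 3: (2.7) for the density (3.16) -/

/-- The absolutely convergent part `Σ_{p ≤ y} χ₄(p)/p²`: for some `D`,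
`|D - Σ_{p ≤ y} χ₄(p)/p²| ≤ 1/⌊y⌋` for `y ≥ 2`. [folklore] -/
theorem sum_chi4_div_sq_tail :
    ∃ D : ℝ, ∀ y : ℝ, 2 ≤ y →
      |D - ∑ p ∈ Nat.primesLE ⌊y⌋₊, (ZMod.χ₄ p : ℝ) / (p : ℝ) ^ 2| ≤ 1 / ⌊y⌋₊ := by
  set f : ℕ → ℝ := fun n => if n.Prime then (ZMod.χ₄ n : ℝ) / (n : ℝ) ^ 2 else 0 with hf
  have hfle : ∀ n, |f n| ≤ ((n : ℝ) ^ 2)⁻¹ := by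
    intro n; simp only [hf]; split_ifs with hp
    · rw [abs_div, abs_of_nonneg (by positivity : (0 : ℝ) ≤ (n : ℝ) ^ 2), div_eq_mul_inv]
      calc |(ZMod.χ₄ n : ℝ)| * ((n : ℝ) ^ 2)⁻¹ ≤ 1 * ((n : ℝ) ^ 2)⁻¹ :=
            mul_le_mul_of_nonneg_right (abs_chi4_cast_le n) (by positivity)
        _ = _ := one_mul _
    · simp
  have hsumabs : Summable (fun n => |f n|) :=
    Summable.of_nonneg_of_le (fun n => abs_nonneg _) hfle (Real.summable_nat_pow_inv.mpr one_lt_two)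
  have hsum : Summable f := hsumabs.of_abs
  refine ⟨∑' n, f n, fun y hy => ?_⟩
  have hy1 : 1 ≤ ⌊y⌋₊ := Nat.le_floor (by norm_num; linarith)
  set N := ⌊y⌋₊ + 1 with hN
  have hsplit : ∑ p ∈ Nat.primesLE ⌊y⌋₊, (ZMod.χ₄ p : ℝ) / (p : ℝ) ^ 2 = ∑ n ∈ Finset.range N, f n := by
    rw [Nat.primesLE, Nat.primesBelow, Finset.sum_filter]
  rw [hsplit, ← hsum.sum_add_tsum_nat_add N, add_sub_cancel_left]
  have hsN : Summable (fun n => ‖f (n + N)‖) := by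
    simpa [Real.norm_eq_abs] using (summable_nat_add_iff N).mpr hsumabs
  refine (Real.norm_eq_abs _ ▸ norm_tsum_le_tsum_norm hsN).trans ?_
  simp only [Real.norm_eq_abs]
  refine Real.tsum_le_of_sum_range_le (fun n => abs_nonneg _) fun n => ?_
  calc ∑ i ∈ Finset.range n, |f (i + N)| ≤ ∑ i ∈ Finset.range n, (((i + N : ℕ) : ℝ) ^ 2)⁻¹ :=
        Finset.sum_le_sum fun i _ => by exact_mod_cast hfle (i + N)
    _ = ∑ k ∈ Finset.Ico N (N + n), ((k : ℝ) ^ 2)⁻¹ := by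
        rw [Finset.sum_Ico_eq_sum_range]
        simp only [add_tsub_cancel_left]
        refine Finset.sum_congr rfl fun i _ => ?_
        rw [add_comm i N]
    _ = ∑ k ∈ Finset.Ioc ⌊y⌋₊ (⌊y⌋₊ + n), ((k : ℝ) ^ 2)⁻¹ := by
        refine Finset.sum_congr ?_ fun _ _ => rfl
        ext k; simp only [hN, Finset.mem_Ico, Finset.mem_Ioc]; omega
    _ ≤ (⌊y⌋₊ : ℝ)⁻¹ - ((⌊y⌋₊ + n : ℕ) : ℝ)⁻¹ := sum_Ioc_inv_sq_le_sub (by omega) (Nat.le_add_right _ _)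
    _ ≤ 1 / ⌊y⌋₊ := by
        rw [one_div]
        have : (0 : ℝ) ≤ ((⌊y⌋₊ + n : ℕ) : ℝ)⁻¹ := by positivity
        linarith

/-- **(2.7) for the density (3.16) from Siegel–Walfisz.** "The asymptotic formula (2.7) is
derived from the Prime Number Theorem for the primes in residue classes modulo four" (FI §3, after
Proposition 3.5): the named fact `FriedlanderIwaniec1998_hyp27`
(`Σ_{p ≤ y} g(p) = log log y + c + O((log y)^{-10})`, `g(p) p = 1 + χ₄(p)(1 - 1/p)`) follows from
the tree's named fact `siegel_walfisz` (parity.S28), via Mertens' theorems for the weights `1` and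
`χ₄` with a log-power rate (two partial summations from `θ(x) = x + O(x (log x)^{-12})`,
`Σ_{p ≤ x} χ₄(p) log p = O(x (log x)^{-12})`).
[cite: FriedlanderIwaniecAnnals1998, §3, paragraph after Proposition 3.5, hypothesis (2.7)] -/
theorem hyp27_of_siegelWalfisz (hSW : siegel_walfisz) : FriedlanderIwaniec1998_hyp27 := by
  obtain ⟨C₁, C₂, hθ, hχ⟩ := chebyshev_inputs_of_siegelWalfisz hSW
  -- weight `1`
  have hΘ₁ : ∀ t : ℝ, 2 ≤ t →
      |(∑ p ∈ Nat.primesLE ⌊t⌋₊, (fun _ : ℕ => (1 : ℝ)) p * Real.log p) - 1 * t| ≤ C₁ * t / Real.log t ^ 12 := by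
    intro t ht
    simpa [Chebyshev.theta_eq_sum_primesLE] using hθ t ht
  obtain ⟨c₁, hc₁⟩ := mertensI_of_chebyshev (fun _ : ℕ => (1 : ℝ)) hΘ₁
  obtain ⟨D₁, hD₁⟩ := mertensII_of_mertensI (fun _ : ℕ => (1 : ℝ)) hc₁
  -- weight `χ₄`
  have hΘ₂ : ∀ t : ℝ, 2 ≤ t →
      |(∑ p ∈ Nat.primesLE ⌊t⌋₊, (fun n : ℕ => (ZMod.χ₄ n : ℝ)) p * Real.log p) - 0 * t| ≤
        C₂ * t / Real.log t ^ 12 := by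
    intro t ht
    simpa using hχ t ht
  obtain ⟨c₂, hc₂⟩ := mertensI_of_chebyshev (fun n : ℕ => (ZMod.χ₄ n : ℝ)) hΘ₂
  obtain ⟨D₂, hD₂⟩ := mertensII_of_mertensI (fun n : ℕ => (ZMod.χ₄ n : ℝ)) hc₂
  -- the `p⁻²` part
  obtain ⟨D₃, hD₃⟩ := sum_chi4_div_sq_tail
  set K₁ : ℝ := (C₁ / Real.log 2 + C₁ / 11) + (C₁ / Real.log 2 + C₁ / 11) / 12 with hK₁
  set K₂ : ℝ := (C₂ / Real.log 2 + C₂ / 11) + (C₂ / Real.log 2 + C₂ / 11) / 12 with hK₂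
  refine ⟨D₁ + D₂ - D₃, (K₁ + K₂) / Real.log 2 ^ 2 + 2 * 10 ^ 10, fun y hy => ?_⟩
  have hy0 : 0 < y := by linarith
  have hly : 0 < Real.log y := Real.log_pos (by linarith)
  have hl2 : 0 < Real.log 2 := Real.log_pos (by norm_num)
  have hl2y : Real.log 2 ≤ Real.log y := Real.log_le_log two_pos hy
  obtain ⟨hfl1, hflle, hflge⟩ : 1 ≤ ⌊y⌋₊ ∧ (⌊y⌋₊ : ℝ) ≤ y ∧ y / 2 ≤ (⌊y⌋₊ : ℝ) := by
    refine ⟨Nat.le_floor (by norm_num; linarith), Nat.floor_le hy0.le, ?_⟩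
    have := Nat.lt_floor_add_one y; linarith
  have h1 := hD₁ y hy
  have h2 := hD₂ y hy
  have h3 := hD₃ y hy
  -- `K₁, K₂ ≥ 0` from the bounds themselves is not needed: we only use the three inequalities
  -- `g(p) = 1/p + χ₄(p)/p - χ₄(p)/p²`
  have hg : ∑ p ∈ Nat.primesLE ⌊y⌋₊, fiDensity p =
      ∑ p ∈ Nat.primesLE ⌊y⌋₊, (fun _ : ℕ => (1 : ℝ)) p / p +
        ∑ p ∈ Nat.primesLE ⌊y⌋₊, (fun n : ℕ => (ZMod.χ₄ n : ℝ)) p / p -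
        ∑ p ∈ Nat.primesLE ⌊y⌋₊, (ZMod.χ₄ p : ℝ) / (p : ℝ) ^ 2 := by
    rw [← Finset.sum_add_distrib, ← Finset.sum_sub_distrib]
    refine Finset.sum_congr rfl fun p hp => ?_
    have hp0 : (p : ℝ) ≠ 0 := by exact_mod_cast (Nat.prime_of_mem_primesLE hp).ne_zero
    rw [fiDensity_prime (Nat.prime_of_mem_primesLE hp)]
    field_simp
    ring
  rw [hg]
  have e : ∑ p ∈ Nat.primesLE ⌊y⌋₊, (fun _ : ℕ => (1 : ℝ)) p / p +
      ∑ p ∈ Nat.primesLE ⌊y⌋₊, (fun n : ℕ => (ZMod.χ₄ n : ℝ)) p / p -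
      ∑ p ∈ Nat.primesLE ⌊y⌋₊, (ZMod.χ₄ p : ℝ) / (p : ℝ) ^ 2 - (Real.log (Real.log y) + (D₁ + D₂ - D₃)) =
      (∑ p ∈ Nat.primesLE ⌊y⌋₊, (fun _ : ℕ => (1 : ℝ)) p / p - 1 * Real.log (Real.log y) - D₁) +
      (∑ p ∈ Nat.primesLE ⌊y⌋₊, (fun n : ℕ => (ZMod.χ₄ n : ℝ)) p / p - 0 * Real.log (Real.log y) - D₂) +
      (D₃ - ∑ p ∈ Nat.primesLE ⌊y⌋₊, (ZMod.χ₄ p : ℝ) / (p : ℝ) ^ 2) := by ring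
  rw [e]
  refine ((abs_add_le _ _).trans (add_le_add (abs_add_le _ _) le_rfl)).trans ?_
  refine (add_le_add (add_le_add h1 h2) h3).trans ?_
  -- `K/(log y)^12 ≤ (K/(log 2)²)/(log y)^10` and `1/⌊y⌋ ≤ 2/y ≤ 2·10¹⁰/(log y)^10`
  have hK₁0 : 0 ≤ K₁ := by
    have := (abs_nonneg _).trans h1
    have hp : 0 < Real.log y ^ 12 := pow_pos hly 12
    exact (div_nonneg_iff.mp this).elim (fun h => h.1) fun h => absurd h.2 (not_le.mpr hp)
  have hK₂0 : 0 ≤ K₂ := by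
    have := (abs_nonneg _).trans h2
    have hp : 0 < Real.log y ^ 12 := pow_pos hly 12
    exact (div_nonneg_iff.mp this).elim (fun h => h.1) fun h => absurd h.2 (not_le.mpr hp)
  have hA : ∀ K : ℝ, 0 ≤ K → K / Real.log y ^ 12 ≤ K / Real.log 2 ^ 2 / Real.log y ^ 10 := by
    intro K hK
    rw [div_div, div_le_div_iff₀ (pow_pos hly 12) (by positivity)]
    calc K * (Real.log 2 ^ 2 * Real.log y ^ 10) ≤ K * (Real.log y ^ 2 * Real.log y ^ 10) := by gcongr
      _ = K * Real.log y ^ 12 := by ring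
  have hB : 1 / (⌊y⌋₊ : ℝ) ≤ 2 * 10 ^ 10 / Real.log y ^ 10 := by
    have hfl : (0 : ℝ) < ⌊y⌋₊ := by exact_mod_cast hfl1
    rw [div_le_div_iff₀ hfl (pow_pos hly 10)]
    -- `(log y)^{10} ≤ 10^{10} y` from `log y ≤ 10 y^{1/10}`
    have hlog10 : Real.log y ^ 10 ≤ 10 ^ 10 * y := by
      have h := Real.log_le_rpow_div hy0.le (by norm_num : (0 : ℝ) < 1 / 10)
      calc Real.log y ^ 10 ≤ (y ^ (1 / 10 : ℝ) / (1 / 10)) ^ 10 := by gcongr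
        _ = 10 ^ 10 * (y ^ (1 / 10 : ℝ)) ^ 10 := by ring
        _ = 10 ^ 10 * y := by
            rw [← Real.rpow_natCast (y ^ (1 / 10 : ℝ)) 10, ← Real.rpow_mul hy0.le]; norm_num
    nlinarith
  calc K₁ / Real.log y ^ 12 + K₂ / Real.log y ^ 12 + 1 / (⌊y⌋₊ : ℝ)
      ≤ K₁ / Real.log 2 ^ 2 / Real.log y ^ 10 + K₂ / Real.log 2 ^ 2 / Real.log y ^ 10 +
          2 * 10 ^ 10 / Real.log y ^ 10 := add_le_add (add_le_add (hA K₁ hK₁0) (hA K₂ hK₂0)) hB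
    _ = ((K₁ + K₂) / Real.log 2 ^ 2 + 2 * 10 ^ 10) / Real.log y ^ 10 := by ring

end Literature.NumberTheory.Sieve.FriedlanderIwaniecPrimesHyp27

namespace Literature.NumberTheory.Sieve

open FriedlanderIwaniecPrimesHyp27

/-- **FI hypothesis (2.7) for the density (3.16), from Siegel–Walfisz** (parity.S28 ⟹ the named
fact `FriedlanderIwaniec1998_hyp27`). [cite: FriedlanderIwaniecAnnals1998, §3, paragraph after Proposition 3.5] -/
theorem FriedlanderIwaniec1998_hyp27_of_siegelWalfisz (hSW : siegel_walfisz) :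
    FriedlanderIwaniec1998_hyp27 :=
  hyp27_of_siegelWalfisz hSW

end Literature.NumberTheory.Sieve
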